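import Mathlib
import HarnessLib
import Summits.Ventures.LatticeQCDFlow.Exactness.SymmetricMetropolis
import Summits.Ventures.LatticeQCDFlow.Exactness.FibreLift

/-!
# The single-link Metropolis hit with the rest of the lattice frozen is exact for the full measure

HONEST FRAMING: exact (Metropolis-corrected) sampling algorithms for lattice gauge theory;
figures of merit are autocorrelation/cost numbers at stated couplings and volumes; no
continuum-physics claim.

Venture `LatticeQCDFlow` (cell pub-lqcd), topic `Exactness`, FANOUT row 9 (eng-latcore, the
engine `latflow.core`).  NEW WORK of the cell over Mathlib; nothing here is cited as a fact.

Glue between `SymmetricMetropolis.lean` (one coordinate, symmetric proposal kernel `P`,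
`symMH_isReversible`) and `FibreLift.lean` (`freezeSnd_isReversible`: fibrewise reversible ⇒
jointly reversible): the engine's `updates.metropolis` touches ONE link `x ∈ X` of a configuration
`(x, y) ∈ X × Y`, proposing from `P(x, ·)` and accepting with `min {1, p(x', y)/p(x, y)}` where
`p = e^{−S}` is the JOINT weight — only the terms of `S` containing the link matter, but nothing
here needs that.

## Content

* `localMH P p : Kernel (X × Y) X` — the `X`-update reading the frozen `y`; `fibre_localMH`: its
  fibre at `y` IS `symMH P (p(·, y))`; `instIsSFiniteKernelLocalMH`.
* `localMH_isReversible` — for a `μ`-symmetric proposal (`(μ ⊗ₘ P).map swap = μ ⊗ₘ P`) and every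
  measurable `p > 0`, `freezeSnd (localMH P p)` is reversible for `p · (μ ⊗ ν)`.
* `linkMetropolis_isReversible` — the instance the engine runs: `X = G` a measurable group with
  left-invariant `μ` (Haar), proposal `U ↦ V U` with `V ∼ ρ` inversion-invariant
  (`mulWalk ρ`, `compProd_mulWalk_swap`): the Metropolis link hit is reversible for
  `p · (Haar ⊗ ν)` whatever the rest of the lattice `(Y, ν)` and the action are.

Not here: sweeps over links and the `N` hits per link (compositions of reversible kernels keep the
measure invariant — `SequentialScanAdjoint.lean`), ergodicity.
-/

namespace Summit.Ventures.LatticeQCDFlow.Exactness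

open MeasureTheory ProbabilityTheory
open scoped ENNReal

variable {X Y : Type*} [MeasurableSpace X] [MeasurableSpace Y]

/-- **Local Metropolis update** of the coordinate `x` reading the frozen `y`: propose
`x' ∼ P(x, ·)`, accept with `min {1, p(x', y) / p(x, y)}`, else keep `x`. -/
noncomputable def localMH (P : Kernel X X) [IsSFiniteKernel P] (p : X × Y → ℝ) : Kernel (X × Y) X :=
  Kernel.withDensity (Kernel.comap P Prod.fst measurable_fst)
      (fun z x' => imhAcceptE (fun x => p (x, z.2)) z.1 x') +
    Kernel.withDensity (Kernel.deterministic Prod.fst measurable_fst)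
      (fun z _ => 1 - symAcceptMass P (fun x => p (x, z.2)) z.1)

variable {P : Kernel X X} [IsSFiniteKernel P] {p : X × Y → ℝ}

/-- Joint measurability of the `y`-dependent acceptance `((x, y), x') ↦ min {1, p(x', y)/p(x, y)}`. -/
theorem measurable_localAccept (hp : Measurable p) :
    Measurable (Function.uncurry fun (z : X × Y) (x' : X) => imhAcceptE (fun x => p (x, z.2)) z.1 x') := by
  unfold imhAcceptE imhAccept
  exact (measurable_const.min ((hp.comp (measurable_snd.prodMk (measurable_snd.comp measurable_fst))).div
    (hp.comp measurable_fst))).ennreal_ofReal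

/-- Joint measurability of the `y`-dependent acceptance mass. -/
theorem measurable_localAcceptMass (hp : Measurable p) :
    Measurable fun z : X × Y => symAcceptMass P (fun x => p (x, z.2)) z.1 := by
  have h := (measurable_localAccept hp).lintegral_kernel_prod_right
    (κ := (Kernel.comap P Prod.fst measurable_fst : Kernel (X × Y) X))
  simpa [symAcceptMass, Kernel.comap_apply] using h

/-- The local Metropolis update is an s-finite kernel (both densities are bounded by one). -/
instance instIsSFiniteKernelLocalMH : IsSFiniteKernel (localMH P p) := by
  haveI h1 : IsSFiniteKernel (Kernel.withDensity (Kernel.comap P Prod.fst measurable_fst : Kernel (X × Y) X)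
      (fun (z : X × Y) (x' : X) => imhAcceptE (fun x => p (x, z.2)) z.1 x')) :=
    Kernel.IsSFiniteKernel.withDensity _
      (fun z x' => ne_top_of_le_ne_top ENNReal.one_ne_top (imhAcceptE_le_one _ _ _))
  haveI h2 : IsSFiniteKernel (Kernel.withDensity
      (Kernel.deterministic Prod.fst measurable_fst : Kernel (X × Y) X)
      (fun (z : X × Y) (_ : X) => 1 - symAcceptMass P (fun x => p (x, z.2)) z.1)) :=
    Kernel.IsSFiniteKernel.withDensity _
      (fun z _ => ne_top_of_le_ne_top ENNReal.one_ne_top tsub_le_self)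
  unfold localMH; infer_instance

/-- **The fibre of the local update at frozen `y` is the symmetric-proposal Metropolis kernel for
the conditional weight `p(·, y)`.** -/
theorem fibre_localMH (hp : Measurable p) (y : Y) :
    fibre (localMH P p) y = symMH P (fun x => p (x, y)) := by
  ext x s hs
  have hpy : Measurable fun x => p (x, y) := hp.comp measurable_prodMk_right
  have h2 : Measurable (Function.uncurry fun (z : X × Y) (_ : X) =>
      1 - symAcceptMass P (fun x => p (x, z.2)) z.1) :=
    measurable_const.sub ((measurable_localAcceptMass (P := P) hp).comp measurable_fst)
  rw [fibre_apply, localMH, Kernel.add_apply, Measure.add_apply,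
    Kernel.withDensity_apply' _ (measurable_localAccept hp), Kernel.withDensity_apply' _ h2,
    Kernel.comap_apply, Kernel.deterministic_apply, symMH_apply hpy x hs, setLIntegral_const,
    Measure.dirac_apply' x hs]

/-- **Local Metropolis with a symmetric proposal is exact for the joint weight.**  If `P` is
`μ`-symmetric, then for every measurable `p > 0` on `X × Y` the lifted update
`freezeSnd (localMH P p)` is reversible for `p · (μ ⊗ ν)`. -/
theorem localMH_isReversible {μ : Measure X} {ν : Measure Y} [SFinite μ] [SFinite ν]
    (hp : Measurable p) (hp0 : ∀ z, 0 < p z) (hP : (μ ⊗ₘ P).map Prod.swap = μ ⊗ₘ P) :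
    Kernel.IsReversible (freezeSnd (localMH P p))
      ((μ.prod ν).withDensity fun z => ENNReal.ofReal (p z)) := by
  refine freezeSnd_isReversible _ hp.ennreal_ofReal (fun y => ?_)
  rw [fibre_localMH hp]
  exact symMH_isReversible (hp.comp measurable_prodMk_right) (fun x => hp0 (x, y)) hP

/-- **The Metropolis link hit is exact for the full lattice measure.**  Links in a measurable
group `G` with left-invariant `μ` (Haar), the rest of the lattice any `(Y, ν)`, joint weight any
measurable `p > 0` (e.g. `e^{−S}`), hit law any inversion-symmetric probability `ρ`: proposing
`U ↦ V U` (`V ∼ ρ`) on one link with everything else frozen and accepting with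
`min {1, p(VU, rest)/p(U, rest)}` is reversible for `p · (μ ⊗ ν)`. -/
theorem linkMetropolis_isReversible {G : Type*} [Group G] [MeasurableSpace G] [MeasurableMul₂ G]
    [MeasurableInv G] {μ : Measure G} [SFinite μ] [μ.IsMulLeftInvariant] {ρ : Measure G}
    [IsProbabilityMeasure ρ] [ρ.IsInvInvariant] {ν : Measure Y} [SFinite ν] {p : G × Y → ℝ}
    (hp : Measurable p) (hp0 : ∀ z, 0 < p z) :
    Kernel.IsReversible (freezeSnd (localMH (mulWalk ρ) p))
      ((μ.prod ν).withDensity fun z => ENNReal.ofReal (p z)) :=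
  localMH_isReversible hp hp0 (compProd_mulWalk_swap μ ρ)

end Summit.Ventures.LatticeQCDFlow.Exactness
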